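import Summits.RiemannHypothesis.RiemannHypothesis.Theorems.IntegerScrewRung512
import Summits.RiemannHypothesis.RiemannHypothesis.Theorems.IntegerScrewTailCriterion
import Summits.RiemannHypothesis.RiemannHypothesis.Theorems.IntegerScrewFiniteExceptionInertia
import Summits.RiemannHypothesis.RiemannHypothesis.Theorems.IntegerScrewPivotUpperBound
import Summits.RiemannHypothesis.RiemannHypothesis.Theorems.IntegerScrewPivotLawDefs
import Summits.RiemannHypothesis.RiemannHypothesis.Theorems.IntegerScrewDeficitLowerBound
import Summits.RiemannHypothesis.RiemannHypothesis.Theorems.IntegerScrewPivotLogBound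
import Summits.RiemannHypothesis.RiemannHypothesis.Theorems.ScrewPolyFloor.Negative.ScrewPolyFloorExponent
import Summits.RiemannHypothesis.RiemannHypothesis.Theorems.ScrewPolyFloor.Negative.ScrewPolyFloorDiagonalInfimum
import HarnessLib

/-!
# Splittings — screw costume detectors II: the SHAPE tails of the pivot ladder, part 1/2 (engine; B19 power-weighted
# monotone tails `M^α·d_M`; B18 plain non-decreasing tail) — SPLIT-screw-neg gen-2 addendum, zero-definition raw form

Cell rh-split, seat rh-split-screw-neg g2 (brief sha16 f79c5f09d8bcb036), card `run/shared/lean/pub/rh-split/cards/SPLIT-screw-neg.md`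
§10 (rows B17–B24 continue the g0 census of `CostumeDetectorsScrew.lean`).

Family equivalence of record: `IntegerScrew.riemannHypothesis_iff_screwPivot_pos : RH ↔ ∀ M ≥ 2, 0 < screwPivot M`.
Vocabulary (spelled out): FIN(H) = `∀ M, 2 ≤ M → M ≤ H → 0 < d_M`; TAIL(H) = `∀ M, H < M → 0 < d_M`; AllPos =
`∀ M ≥ 2, 0 < d_M` (↔ RH); the SHAPE tails above a cut `H`: non-decreasing / non-increasing / ratio `θ·d_M ≤ d_{M+1}` /
power-weighted `M^α d_M` non-decreasing / concave / convex / deficit band `M·(2Ψ(h_M) − d_M)·log M ≤ ε`; determinant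
signs `screwDet n > 0 / ≥ 0 / ≠ 0`.

ENGINE (two tree inputs, both RH-free given positive definiteness): the log envelope `screwPivot_le_log_div`
(`S_{M−1} ≻ 0 ⟹ d_M ≤ (log M + 4)/(M − 1)`, hence under AllPos `M·d_M ≤ (3/2)(log M + 4)`) and the arithmetic deficit
floor `deficit_mul_log_ge` (`S_{M−1} ≻ 0, M ≥ 122 ⟹ M·(2Ψ(h_M) − d_M)·log M ≥ log²2 − 57/(M−2)`); analytic core
`exists_envelope_lt_rpow` (`(3/2)(log M + 4) < c·M^β` at some level above any cut).

ROWS in this part: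
* B19 power-weighted tails (`M^α·d_M` non-decreasing above `H`): a VALID conjunct with `FIN(H+1)` for every real `α`
  (`rh_of_fin_powNondecTail`); for `α < 1` RH-INCONSISTENT for every `H` (`not_rh_of_powNondecTail`) and REFUTED
  outright for `H ≤ 511` (`not_powNondecTail_of_le_511`); `α = 1` is B8 — the undecidable boundary of the one-sided
  information in the tree.
* B18 (`α = 0`, g0 row B6 now for every cut): a non-decreasing pivot tail above ANY `H` ⟹ `¬RH`
  (`not_rh_of_nondecTail`; the outright refutation for `H ≤ 511` is the landed
  `CostumeDetectorsScrew.not_nondecreasingTail_of_le_511`).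

Provenance: zero-definition raw form (the 13 seat-local Props `FinPiv`/`TailPiv`/`AllPos`/`NondecTail`/`NonincTail`/
`RatioTail`/`PowNondecTail`/`ConcaveTail`/`ConvexTail`/`DeficitBandTail`/`DetPos`/`DetNonneg`/`DetNonzero` SPELLED OUT;
proofs verbatim) of `HOME/rh-split-screw-neg/SplitScrewNegG2.lean` (sha16 183b9d0f3c69f0ba, 503 lines), filed in two
parts (`CostumeDetectorsScrewII` = engine + B19 + B18, `CostumeDetectorsScrewIII` = B20–B24) by rh-split-typer-1 g2
(lead HANDOFF §8, optional item «raw-ify + split ≤ 400 → CostumeDetectorsScrew II»).  Referee (rh-split-ref g0)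
addendum 20:02Z on cards/SPLIT-screw-neg.md §10: replay rc 0, std on `not_powNondecTail_of_le_511` +
`not_rh_of_deficitBandTail`; «band numbers and the B19/B20/B21/B22 propagation arguments re-checked on paper;
α-dichotomy (boundary α = 1 = B8) endorsed; class UNCHANGED barrier note, 0 new survivors».  Typer replay: farm rc 0,
0 warnings, 0 sorry, std axioms.

HONEST LABEL: SPLITTING SEARCH over kernel-typed RH-EQUIVALENCES; a splitting A ∧ B ⟹ RH is CONDITIONAL
bookkeeping unless A and B are both proved; nothing here bears on the truth of RH.
-/

noncomputable section

set_option linter.dupNamespace false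

namespace Summit.RiemannHypothesis.RiemannHypothesis.Theorems.Splittings.CostumeDetectorsScrewII

open Literature.NumberTheory.LFunctions
open Summit.RiemannHypothesis.RiemannHypothesis.Theorems.IntegerScrew
open Summit.RiemannHypothesis.RiemannHypothesis.Theses.IntegerScrew

/-! ## Bookkeeping -/

/-- AllPos ↔ RH (tree `riemannHypothesis_iff_screwPivot_pos`, re-oriented). -/
theorem allPos_iff_rh : (∀ M : ℕ, 2 ≤ M → 0 < screwPivot M) ↔ _root_.RiemannHypothesis := riemannHypothesis_iff_screwPivot_pos.symm

/-- FIN(512): the kernel-certified floor `screwPivot_pos_of_le_512`. -/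
theorem finPiv_512 : (∀ M : ℕ, 2 ≤ M → M ≤ 512 → 0 < screwPivot M) := fun _ hM hM' => screwPivot_pos_of_le_512 hM hM'

/-- FIN(H) ∧ TAIL(H) ⟹ AllPos. [folklore] -/
theorem allPos_of_fin_tail (H : ℕ) (hA : (∀ M : ℕ, 2 ≤ M → M ≤ H → 0 < screwPivot M)) (hB : (∀ M : ℕ, H < M → 0 < screwPivot M)) : (∀ M : ℕ, 2 ≤ M → 0 < screwPivot M) := fun M hM => by
  rcases Nat.lt_or_ge H M with h | h
  · exact hB M h
  · exact hA M hM h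

/-- FIN(H) ∧ TAIL(H) ⟹ RH (the family splitting, both conjuncts consumed). -/
theorem rh_of_fin_tail (H : ℕ) (hA : (∀ M : ℕ, 2 ≤ M → M ≤ H → 0 < screwPivot M)) (hB : (∀ M : ℕ, H < M → 0 < screwPivot M)) : _root_.RiemannHypothesis :=
  allPos_iff_rh.mp (allPos_of_fin_tail H hA hB)

/-! ## Engine: the log envelope under `AllPos`, and the analytic core -/

/-- `S_{M−1} ≻ 0`, `M ≥ 3` ⟹ `M·d_M ≤ (3/2)(log M + 4)` (RH-free given the positive definiteness). -/
theorem level_mul_pivot_le_of_posDef (M : ℕ) (hM : 3 ≤ M) (hPD : (screwMatrix (M - 2)).PosDef) :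
    (M : ℝ) * screwPivot M ≤ 3 / 2 * (Real.log M + 4) := by
  have hM' : (3 : ℝ) ≤ (M : ℝ) := by exact_mod_cast hM
  have h := screwPivot_le_log_div M hM hPD
  have hlog0 : 0 ≤ Real.log (M : ℝ) := Real.log_nonneg (by linarith)
  have h1 : screwPivot M * ((M : ℝ) - 1) ≤ Real.log M + 4 := by
    rwa [le_div_iff₀ (by linarith)] at h
  have h2 : screwPivot M ≤ (Real.log M + 4) / 2 := by
    refine le_trans h ?_
    exact div_le_div_of_nonneg_left (by linarith) (by norm_num) (by linarith)
  have h3 : (M : ℝ) * screwPivot M = screwPivot M * ((M : ℝ) - 1) + screwPivot M := by ring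
  linarith

/-- The log envelope under AllPos: `M·d_M ≤ (3/2)(log M + 4)` (tree `screwPivot_le_log_div`). -/
theorem level_mul_pivot_le_of_allPos (hall : (∀ M : ℕ, 2 ≤ M → 0 < screwPivot M)) (M : ℕ) (hM : 3 ≤ M) :
    (M : ℝ) * screwPivot M ≤ 3 / 2 * (Real.log M + 4) :=
  level_mul_pivot_le_of_posDef M hM (screwMatrix_posDef_of_screwPivot_pos hall (M - 2))

/-- Under `AllPos`, `d_M ≤ 3` for `M ≥ 3`. -/
theorem pivot_le_three_of_allPos (hall : (∀ M : ℕ, 2 ≤ M → 0 < screwPivot M)) (M : ℕ) (hM : 3 ≤ M) : screwPivot M ≤ 3 := by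
  have h := screwPivot_le_log_div M hM (screwMatrix_posDef_of_screwPivot_pos hall (M - 2))
  have hM' : (3 : ℝ) ≤ (M : ℝ) := by exact_mod_cast hM
  have hlog : Real.log (M : ℝ) ≤ (M : ℝ) - 1 := Real.log_le_sub_one_of_pos (by linarith)
  have h1 : screwPivot M * ((M : ℝ) - 1) ≤ Real.log M + 4 := by
    rwa [le_div_iff₀ (by linarith)] at h
  by_contra hlt
  push Not at hlt
  have h2 : 3 * ((M : ℝ) - 1) < screwPivot M * ((M : ℝ) - 1) :=
    mul_lt_mul_of_pos_right hlt (by linarith)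
  linarith

/-- Analytic core: for `c, β > 0` the envelope `(3/2)(log M + 4)` drops below `c·M^β` at some
level `M > H`, `M ≥ 3`. -/
theorem exists_envelope_lt_rpow {c β : ℝ} (hc : 0 < c) (hβ : 0 < β) (H : ℕ) :
    ∃ M : ℕ, H < M ∧ 3 ≤ M ∧ 3 / 2 * (Real.log M + 4) < c * (M : ℝ) ^ β := by
  have hβ3 : 0 < 3 / β := div_pos (by norm_num) hβ
  set Y : ℝ := (3 / β + 6) / c + 1 with hY
  have hY1 : 1 ≤ Y := by
    have : 0 ≤ (3 / β + 6) / c := div_nonneg (by linarith) hc.le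
    linarith
  have hY0 : 0 ≤ Y := by linarith
  set M : ℕ := max (H + 1) (max 3 ⌈Y ^ (2 / β)⌉₊) with hM
  refine ⟨M, by omega, by omega, ?_⟩
  have hM3 : (3 : ℝ) ≤ (M : ℝ) := by exact_mod_cast (show 3 ≤ M by omega)
  have hM0 : (0 : ℝ) ≤ (M : ℝ) := by linarith
  have hMY : Y ^ (2 / β) ≤ (M : ℝ) := by
    have h1 : Y ^ (2 / β) ≤ (⌈Y ^ (2 / β)⌉₊ : ℝ) := Nat.le_ceil _
    have h2 : ((⌈Y ^ (2 / β)⌉₊ : ℕ) : ℝ) ≤ (M : ℝ) := by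
      exact_mod_cast (show ⌈Y ^ (2 / β)⌉₊ ≤ M by omega)
    linarith
  -- y := M^(β/2) ≥ Y
  have hyY : Y ≤ (M : ℝ) ^ (β / 2) := by
    have h1 : (Y ^ (2 / β)) ^ (β / 2) ≤ (M : ℝ) ^ (β / 2) :=
      Real.rpow_le_rpow (Real.rpow_nonneg hY0 _) hMY (by linarith)
    have h2 : (Y ^ (2 / β)) ^ (β / 2) = Y := by
      rw [← Real.rpow_mul hY0]
      have : 2 / β * (β / 2) = 1 := by field_simp
      rw [this, Real.rpow_one]
    rw [h2] at h1
    exact h1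
  set y : ℝ := (M : ℝ) ^ (β / 2) with hy
  have hy1 : 1 ≤ y := le_trans hY1 hyY
  have hlog : Real.log M ≤ y / (β / 2) := Real.log_le_rpow_div hM0 (by linarith)
  have hdiv : y / (β / 2) = 2 / β * y := by ring
  have hlog' : Real.log M ≤ 2 / β * y := by linarith
  have hMβ : (M : ℝ) ^ β = y ^ 2 := by
    rw [hy, ← Real.rpow_two, ← Real.rpow_mul hM0]
    congr 1
    ring
  have hcy : 3 / β + 6 < c * y := by
    have h2 : (3 / β + 6) / c < y := by linarith
    rwa [div_lt_iff₀ hc, mul_comm] at h2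
  rw [hMβ]
  have h36 : 3 / 2 * (Real.log M + 4) ≤ 3 / β * y + 6 := by
    have : 3 / 2 * (2 / β * y) = 3 / β * y := by ring
    linarith
  have hfin : 3 / β * y + 6 < c * y ^ 2 := by
    nlinarith [mul_lt_mul_of_pos_right hcy (by linarith : (0 : ℝ) < y), hy1, hβ3]
  linarith

/-! ## B19: power-weighted monotone tails `M^α · d_M` non-decreasing -/

/-- A power-weighted non-decreasing tail propagates: `(H+1)^α d_{H+1} ≤ (H+1+n)^α d_{H+1+n}`. [folklore] -/
theorem powNondecTail_mono {α : ℝ} {H : ℕ} (hB : (∀ M : ℕ, H < M → (M : ℝ) ^ ((α) : ℝ) * screwPivot M ≤ ((M + 1 : ℕ) : ℝ) ^ ((α) : ℝ) * screwPivot (M + 1))) (n : ℕ) :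
    ((H + 1 : ℕ) : ℝ) ^ α * screwPivot (H + 1)
      ≤ ((H + 1 + n : ℕ) : ℝ) ^ α * screwPivot (H + 1 + n) := by
  induction n with
  | zero => simp
  | succ n ih =>
    have h := hB (H + 1 + n) (by omega)
    have he : H + 1 + (n + 1) = H + 1 + n + 1 := by omega
    rw [he]
    exact le_trans ih h

/-- VALID as a conjunct for every real `α`: `FIN(H+1) ∧ PowNondecTail α H ⟹ AllPos (↔ RH)`. -/
theorem allPos_of_fin_powNondecTail (α : ℝ) (H : ℕ) (hH : 1 ≤ H) (hA : (∀ M : ℕ, 2 ≤ M → M ≤ (H + 1) → 0 < screwPivot M))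
    (hB : (∀ M : ℕ, H < M → (M : ℝ) ^ ((α) : ℝ) * screwPivot M ≤ ((M + 1 : ℕ) : ℝ) ^ ((α) : ℝ) * screwPivot (M + 1))) : (∀ M : ℕ, 2 ≤ M → 0 < screwPivot M) := by
  intro M hM
  rcases Nat.lt_or_ge (H + 1) M with hlt | hle
  · obtain ⟨n, rfl⟩ : ∃ n, M = H + 1 + n := ⟨M - (H + 1), by omega⟩
    have hmono := powNondecTail_mono hB n
    have hd1 : 0 < screwPivot (H + 1) := hA (H + 1) (by omega) le_rfl
    have hp1 : 0 < ((H + 1 : ℕ) : ℝ) ^ α := Real.rpow_pos_of_pos (Nat.cast_pos.mpr (by omega)) α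
    have hpM : 0 < ((H + 1 + n : ℕ) : ℝ) ^ α :=
      Real.rpow_pos_of_pos (Nat.cast_pos.mpr (by omega)) α
    have hprod : 0 < ((H + 1 + n : ℕ) : ℝ) ^ α * screwPivot (H + 1 + n) :=
      lt_of_lt_of_le (mul_pos hp1 hd1) hmono
    exact pos_of_mul_pos_right hprod hpM.le
  · exact hA M hM hle

/-- B19 VALID as a conjunct: `FIN(H+1) ∧ (M^α d_M non-decreasing above H) ⟹ RH`, every real `α`. -/
theorem rh_of_fin_powNondecTail (α : ℝ) (H : ℕ) (hH : 1 ≤ H) (hA : (∀ M : ℕ, 2 ≤ M → M ≤ (H + 1) → 0 < screwPivot M))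
    (hB : (∀ M : ℕ, H < M → (M : ℝ) ^ ((α) : ℝ) * screwPivot M ≤ ((M + 1 : ℕ) : ℝ) ^ ((α) : ℝ) * screwPivot (M + 1))) : _root_.RiemannHypothesis :=
  allPos_iff_rh.mp (allPos_of_fin_powNondecTail α H hH hA hB)

/-- For `α < 1` the power-weighted monotone tail contradicts `AllPos`: it forces a floor
`c ≤ M^α·d_M` (`c = (H'+1)^α d_{H'+1} > 0`), while the envelope gives `M·d_M ≤ (3/2)(log M + 4)`,
i.e. `c·M^{1−α} ≤ (3/2)(log M + 4)` — impossible for large `M`. -/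
theorem not_powNondecTail_of_allPos (hall : (∀ M : ℕ, 2 ≤ M → 0 < screwPivot M)) {α : ℝ} (hα : α < 1) (H : ℕ) :
    ¬ (∀ M : ℕ, H < M → (M : ℝ) ^ ((α) : ℝ) * screwPivot M ≤ ((M + 1 : ℕ) : ℝ) ^ ((α) : ℝ) * screwPivot (M + 1)) := by
  intro hB
  set H' : ℕ := max H 1 with hH'
  have hB' : (∀ M : ℕ, H' < M → (M : ℝ) ^ ((α) : ℝ) * screwPivot M ≤ ((M + 1 : ℕ) : ℝ) ^ ((α) : ℝ) * screwPivot (M + 1)) := fun M hM => hB M (by omega)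
  set c : ℝ := ((H' + 1 : ℕ) : ℝ) ^ α * screwPivot (H' + 1) with hc
  have hcpos : 0 < c :=
    mul_pos (Real.rpow_pos_of_pos (Nat.cast_pos.mpr (by omega)) α) (hall (H' + 1) (by omega))
  obtain ⟨M, hHM, hM3, hlt⟩ := exists_envelope_lt_rpow hcpos (by linarith : 0 < 1 - α) (H' + 1)
  obtain ⟨n, rfl⟩ : ∃ n, M = H' + 1 + n := ⟨M - (H' + 1), by omega⟩
  have hfloor := powNondecTail_mono hB' n
  have henv := level_mul_pivot_le_of_allPos hall (H' + 1 + n) hM3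
  have hM0 : (0 : ℝ) < ((H' + 1 + n : ℕ) : ℝ) := Nat.cast_pos.mpr (by omega)
  have hpow : 0 < ((H' + 1 + n : ℕ) : ℝ) ^ (1 - α) := Real.rpow_pos_of_pos hM0 _
  have hαβ : ((H' + 1 + n : ℕ) : ℝ) ^ α * ((H' + 1 + n : ℕ) : ℝ) ^ (1 - α)
      = ((H' + 1 + n : ℕ) : ℝ) := by
    rw [← Real.rpow_add hM0, show α + (1 - α) = (1 : ℝ) by ring, Real.rpow_one]
  have h1 : c * ((H' + 1 + n : ℕ) : ℝ) ^ (1 - α)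
      ≤ ((H' + 1 + n : ℕ) : ℝ) ^ α * screwPivot (H' + 1 + n) * ((H' + 1 + n : ℕ) : ℝ) ^ (1 - α) :=
    mul_le_mul_of_nonneg_right hfloor hpow.le
  have h2 : ((H' + 1 + n : ℕ) : ℝ) ^ α * screwPivot (H' + 1 + n) * ((H' + 1 + n : ℕ) : ℝ) ^ (1 - α)
      = ((H' + 1 + n : ℕ) : ℝ) * screwPivot (H' + 1 + n) := by
    rw [mul_right_comm, hαβ]
  linarith

/-- **B19, `α < 1`: RH-INCONSISTENT for every cut.** -/
theorem not_rh_of_powNondecTail {α : ℝ} (hα : α < 1) (H : ℕ) (hB : (∀ M : ℕ, H < M → (M : ℝ) ^ ((α) : ℝ) * screwPivot M ≤ ((M + 1 : ℕ) : ℝ) ^ ((α) : ℝ) * screwPivot (M + 1))) :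
    ¬ _root_.RiemannHypothesis :=
  fun hRH => not_powNondecTail_of_allPos (allPos_iff_rh.mpr hRH) hα H hB

/-- **B19, `α < 1`: REFUTED outright given the certified base `FIN(H+1)`.** -/
theorem not_powNondecTail_of_fin {α : ℝ} (hα : α < 1) (H : ℕ) (hH : 1 ≤ H) (hA : (∀ M : ℕ, 2 ≤ M → M ≤ (H + 1) → 0 < screwPivot M)) :
    ¬ (∀ M : ℕ, H < M → (M : ℝ) ^ ((α) : ℝ) * screwPivot M ≤ ((M + 1 : ℕ) : ℝ) ^ ((α) : ℝ) * screwPivot (M + 1)) :=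
  fun hB => not_powNondecTail_of_allPos (allPos_of_fin_powNondecTail α H hH hA hB) hα H hB

/-- B19 REFUTED outright for `α < 1`, `H ≤ 511` (FIN(512) is kernel-certified). -/
theorem not_powNondecTail_of_le_511 {α : ℝ} (hα : α < 1) (H : ℕ) (hH : H ≤ 511) :
    ¬ (∀ M : ℕ, H < M → (M : ℝ) ^ ((α) : ℝ) * screwPivot M ≤ ((M + 1 : ℕ) : ℝ) ^ ((α) : ℝ) * screwPivot (M + 1)) := by
  intro hB
  have hB' : (∀ M : ℕ, (max H 1) < M → (M : ℝ) ^ ((α) : ℝ) * screwPivot M ≤ ((M + 1 : ℕ) : ℝ) ^ ((α) : ℝ) * screwPivot (M + 1)) := fun M hM => hB M (by omega)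
  exact not_powNondecTail_of_fin hα (max H 1) (le_max_right _ _)
    (fun M hM hMH => finPiv_512 M hM (by omega)) hB'

/-! ## B18: the plain non-decreasing tail is the case `α = 0` — RH-inconsistent for EVERY cut -/

/-- `α = 0`: the power-weighted tail is the plain non-decreasing tail. -/
theorem powNondecTail_zero_iff (H : ℕ) : (∀ M : ℕ, H < M → (M : ℝ) ^ (0 : ℝ) * screwPivot M ≤ ((M + 1 : ℕ) : ℝ) ^ (0 : ℝ) * screwPivot (M + 1)) ↔ (∀ M : ℕ, H < M → screwPivot M ≤ screwPivot (M + 1)) := by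
  simp [Real.rpow_zero]

/-- B18: a non-decreasing pivot tail above ANY cut `H` is RH-INCONSISTENT. -/
theorem not_rh_of_nondecTail (H : ℕ) (hB : (∀ M : ℕ, H < M → screwPivot M ≤ screwPivot (M + 1))) : ¬ _root_.RiemannHypothesis :=
  not_rh_of_powNondecTail (by norm_num) H ((powNondecTail_zero_iff H).mpr hB)

-- B18 refuted outright for `H ≤ 511`: already landed as `CostumeDetectorsScrew.not_nondecreasingTail_of_le_511` (g0 file).

end Summit.RiemannHypothesis.RiemannHypothesis.Theorems.Splittings.CostumeDetectorsScrewII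

end
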